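import Literature.IUT.HodgeTheaters.InitialThetaDataLocalGalois
import Literature.IUT.HodgeTheaters.InitialThetaDataLocalGroups
import HarnessLib

/-!
# [IUTchI] Def. 3.1 (d), (e): the `K`-level groups `Π_{X_K}, Π_{C_K}, Π_{X̲_K}, Π_{C̲_K}` are OPEN in `Π_{C_F}`, and their
# base changes `Π_{X_v̲}, Π_{C_v̲}, Π_{X̲_v̲}, Π_{C̲_v̲}` surject onto `G_v̲` by open maps — hypothesis-free (proofs)

`Proofs` companion (theorems only; no definitions, no instances) of `InitialThetaData.lean` /
`InitialThetaDataLocalGroups.lean` (abc-iut-L5-t2). S. Mochizuki, *Inter-universal Teichmüller theory I*, Def. 3.1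
(d), (e) (kurims May-2020 manuscript pp. 62–63) [claim: Mochizuki2012, status: disputed]: (d) "natural cartesian diagrams
`X_K → X_F`, `C_K → C_F`, `Π_{X_K} → Π_{X_F}`, `Π_{C_K} → Π_{C_F}` … of finite étale coverings of hyperbolic orbicurves
and corresponding open immersions of profinite groups … open subgroups `Δ_{X̲} ⊆ Δ_{C̲} ⊆ Δ_C`"; (e) "`Δ_X → Π_{X̲_v̲} → Π_{X_v}`
… natural outer surjections onto the decomposition group `G_v ⊆ G_K`".

For `D : InitialThetaData F K Fbar E l P` this file PROVES, from the fields of the frozen structures alone: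
* `isOpen_galoisSubgroupOf` — `G_K ⊆ G_F` is open (`K/F` finite: `G_K` contains the open fixing subgroup of the
  subfield generated by an `F`-basis of `K`, Mathlib `IntermediateField.fixingSubgroup_isOpen`; cf. abc-iut-S2's
  `ThetaGeometryModel.galoisSubgroupOf_eq_fixingSubgroup` / `isClosed_galoisSubgroupOf`);
* `isOpenEmbedding_embK` — `Π_{C_K} ↪ Π_{C_F}` is an OPEN immersion ("open immersions of profinite groups":
  continuous injective between profinite groups with open range `augGF⁻¹(G_K)`);
* `isOpen_PiCK`, `isOpen_PiXK`, `isOpen_PiXund`, `isOpen_PiCund` — **`Π_{C_K}, Π_{X_K}, Π_{X̲_K}, Π_{C̲_K} ⊆ Π_{C_F}` are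
  OPEN** (images of the open `Π_X ∩ Π_{C̲}`, `Π_{C̲}` of §1 under the open immersion);
* `PiXund_le_PiXK`, `PiXund_le_PiCK`, `PiXund_le_PiCund`, `galoisSubgroupOf_le_map_PiXund` (`Π_{X̲_K} ↠ G_K`, field
  `aug_PiXbar` of `ThetaGeometry`) and `galoisSubgroupOf_le_map_of_PiXund_le`;
* hence, for the base change of `InitialThetaDataLocalGroups.lean` along the restriction
  `ρ = localToGF F k ι : Gal(Ω/k) → G_F` of `InitialThetaDataLocalGalois.lean` (`k = K_v̲`): **`Π_{(−)_v̲} ↠ Gal(Ω/k)` is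
  SURJECTIVE for every `Π_{(−)} ⊇ Π_{X̲_K}` and OPEN for `Π_{(−)} ∈ {Π_{X_K}, Π_{C_K}, Π_{X̲_K}, Π_{C̲_K}}` WITHOUT any
  hypothesis** (`augLoc_localToGF_surjective_of_PiXund_le`, `isOpenMap_augLoc_PiXK/PiCK/PiXund/PiCund`). The one group
  of (f) for which openness is NOT derivable from the frozen fields is `Π_{X̲→_K}` (Def. 1.1's construction; carried as
  the hypothesis `hX` in `InitialThetaDataGoodLocalFrobenioid.lean`).
Nothing of the disputed series is asserted; no side is taken.
-/

noncomputable section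

namespace Literature.IUT.HodgeTheaters

open Topology

universe u v w w'

namespace InitialThetaData

section Open

variable {F : Type u} {K : Type v} {Fbar : Type w} [Field F] [NumberField F] [Field K] [NumberField K]
  [Algebra F K] [Field Fbar] [Algebra F Fbar] [Algebra K Fbar]
  {E : WeierstrassCurve F} [E.IsElliptic] {l : ℕ} {Pb : BadPlacePredicates K}
  (D : InitialThetaData F K Fbar E l Pb)

/-- `K` is a finite extension of `F` (two number fields). [claim: Mochizuki2012, status: disputed] -/
theorem finiteDimensional_K : FiniteDimensional F K := Module.Finite.of_restrictScalars_finite ℚ F K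

/-- **`G_K ⊆ G_F` is OPEN** (Krull topology): `G_K = Gal(F̄/K)` is the fixing subgroup of the finite extension
`K ⊆ F̄` of `F`: it contains the fixing subgroup of the finite-dimensional subfield generated by an `F`-basis of `K`,
which is open (Mathlib `IntermediateField.fixingSubgroup_isOpen`). [claim: Mochizuki2012, status: disputed] -/
theorem isOpen_galoisSubgroupOf [IsScalarTower F K Fbar] :
    IsOpen (galoisSubgroupOf F K Fbar : Set (Fbar ≃ₐ[F] Fbar)) := by
  haveI := finiteDimensional_K (F := F) (K := K)
  let b := Module.finBasis F K
  let S : Set Fbar := Set.range fun i => algebraMap K Fbar (b i)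
  haveI : FiniteDimensional F (IntermediateField.adjoin F S) := by
    refine IntermediateField.finiteDimensional_adjoin fun x hx => ?_
    obtain ⟨i, rfl⟩ := hx
    exact (IsIntegral.of_finite F (b i)).map (IsScalarTower.toAlgHom F K Fbar)
  refine Subgroup.isOpen_mono (H₁ := (IntermediateField.adjoin F S).fixingSubgroup) ?_
    (IntermediateField.fixingSubgroup_isOpen _)
  intro σ hσ y
  rw [IntermediateField.mem_fixingSubgroup_iff] at hσ
  have key : ∀ i, σ (algebraMap K Fbar (b i)) = algebraMap K Fbar (b i) := fun i =>
    hσ _ (IntermediateField.subset_adjoin F S ⟨i, rfl⟩)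
  have := b.ext (f₁ := (σ : Fbar ≃ₐ[F] Fbar).toLinearMap ∘ₗ (IsScalarTower.toAlgHom F K Fbar).toLinearMap)
    (f₂ := (IsScalarTower.toAlgHom F K Fbar).toLinearMap) (fun i => by simpa using key i)
  exact congr($this y)

/-- The range of `Π_{C_K} ↪ Π_{C_F}` is `augGF⁻¹(G_K)` (field `embK_range` of `ThetaGeometry`), as sets.
[claim: Mochizuki2012, status: disputed] -/
theorem range_embK : Set.range D.geom.embK = D.augGF ⁻¹' (galoisSubgroupOf F K Fbar : Set (Fbar ≃ₐ[F] Fbar)) := by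
  have h := congrArg (fun H : Subgroup D.PiC => (H : Set D.PiC)) D.geom.embK_range
  rw [MonoidHom.coe_range, Subgroup.coe_comap] at h
  exact h

/-- **`Π_{C_K} ↪ Π_{C_F}` is an OPEN immersion** (Def. 3.1 (d) "open immersions of profinite groups"): a continuous
injection of profinite groups (closed embedding) with open range `augGF⁻¹(G_K)`.
[claim: Mochizuki2012, status: disputed] -/
theorem isOpenEmbedding_embK [IsScalarTower F K Fbar] : IsOpenEmbedding D.geom.embK :=
  ⟨(D.geom.embK_continuous.isClosedEmbedding D.geom.embK_injective).isEmbedding, by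
    rw [D.range_embK]
    exact (isOpen_galoisSubgroupOf (F := F) (K := K) (Fbar := Fbar)).preimage D.continuous_augGF⟩

/-- **`Π_{C_K} ⊆ Π_{C_F}` is open.** [claim: Mochizuki2012, status: disputed] -/
theorem isOpen_PiCK [IsScalarTower F K Fbar] : IsOpen (D.PiCK : Set D.PiC) := by
  change IsOpen ((D.geom.embK.range : Subgroup D.PiC) : Set D.PiC)
  rw [MonoidHom.coe_range]
  exact D.isOpenEmbedding_embK.isOpen_range

/-- **`Π_{X_K} = Π_{X_F} ∩ Π_{C_K} ⊆ Π_{C_F}` is open.** [claim: Mochizuki2012, status: disputed] -/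
theorem isOpen_PiXK [IsScalarTower F K Fbar] : IsOpen (D.PiXK : Set D.PiC) :=
  D.geom.PiX_isOpen.inter D.isOpen_PiCK

/-- **`Π_{X̲_K} ⊆ Π_{C_F}` is open**: the image of the open `Π_{X̲} = Π_X ∩ Π_{C̲}` of §1 under the open immersion
`Π_{C_K} ↪ Π_{C_F}`. [claim: Mochizuki2012, status: disputed] -/
theorem isOpen_PiXund [IsScalarTower F K Fbar] : IsOpen (D.PiXund : Set D.PiC) := by
  change IsOpen ((D.geom.pe.PiXbar.map D.geom.embK : Subgroup D.PiC) : Set D.PiC)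
  rw [Subgroup.coe_map]
  exact D.isOpenEmbedding_embK.isOpenMap _ (D.geom.pe.isOpen_piX.inter D.geom.pe.isOpen_piCbar)

/-- **`Π_{C̲_K} ⊆ Π_{C_F}` is open**: the image of the open `Π_{C̲}` of §1 under the open immersion.
[claim: Mochizuki2012, status: disputed] -/
theorem isOpen_PiCund [IsScalarTower F K Fbar] : IsOpen (D.PiCund : Set D.PiC) := by
  change IsOpen ((D.geom.pe.PiCbar.map D.geom.embK : Subgroup D.PiC) : Set D.PiC)
  rw [Subgroup.coe_map]
  exact D.isOpenEmbedding_embK.isOpenMap _ D.geom.pe.isOpen_piCbar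

/-- `Π_{X̲_K} ⊆ Π_{C̲_K}`. [claim: Mochizuki2012, status: disputed] -/
theorem PiXund_le_PiCund : D.PiXund ≤ D.PiCund := Subgroup.map_mono inf_le_right

/-- `Π_{X̲_K} ⊆ Π_{C_K}`. [claim: Mochizuki2012, status: disputed] -/
theorem PiXund_le_PiCK : D.PiXund ≤ D.PiCK := Subgroup.map_le_range _ _

/-- `Π_{X̲_K} ⊆ Π_{X_K}` (`Π_{X̲} ⊆ Π_X` and `Π_{X_K} = Π_{X_F} ∩ Π_{C_K}` is the image of `Π_X`, field `embK_PiX`).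
[claim: Mochizuki2012, status: disputed] -/
theorem PiXund_le_PiXK : D.PiXund ≤ D.PiXK := by
  change D.geom.pe.PiXbar.map D.geom.embK ≤ D.geom.PiX ⊓ D.geom.embK.range
  rw [← D.geom.embK_PiX]
  exact Subgroup.map_mono inf_le_left

/-- **`Π_{X̲_K} ↠ G_K`**: every element of `G_K ⊆ G_F` is `augGF` of an element of `Π_{X̲_K}` (field `aug_PiXbar` of
`ThetaGeometry`: "`X̲_K → X_K` … is geometric", transported through `embK`, `galKIso`, `aug_compat`).
[claim: Mochizuki2012, status: disputed] -/
theorem galoisSubgroupOf_le_map_PiXund : galoisSubgroupOf F K Fbar ≤ D.PiXund.map D.augGF := by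
  intro g hg
  obtain ⟨y, hy⟩ := D.geom.aug_PiXbar (D.geom.galKIso.symm ⟨g, hg⟩)
  refine ⟨D.geom.embK y, Subgroup.mem_map_of_mem _ y.2, ?_⟩
  rw [augGF_apply, D.geom.aug_compat]
  change ((D.geom.galKIso ((D.geom.pe.E.aug.toMonoidHom.comp D.geom.pe.PiXbar.subtype) y) :
    galoisSubgroupOf F K Fbar) : Fbar ≃ₐ[F] Fbar) = g
  rw [hy, MulEquiv.apply_symm_apply]

/-- `Π_{(−)} ↠ G_K` for every `Π_{(−)} ⊇ Π_{X̲_K}` (in particular `Π_{X_K}, Π_{C_K}, Π_{C̲_K}`).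
[claim: Mochizuki2012, status: disputed] -/
theorem galoisSubgroupOf_le_map_of_PiXund_le {H : Subgroup D.PiC} (hH : D.PiXund ≤ H) :
    galoisSubgroupOf F K Fbar ≤ H.map D.augGF :=
  D.galoisSubgroupOf_le_map_PiXund.trans (Subgroup.map_mono hH)

end Open

/-! ### Base change along `Gal(Ω/k) → G_F`: surjective and open, hypothesis-free -/

section BaseChange

variable {F : Type u} {K : Type v} {Fbar : Type w} [Field F] [NumberField F] [Field K] [NumberField K]
  [Algebra F K] [Field Fbar] [Algebra F Fbar] [Algebra K Fbar] [IsScalarTower F K Fbar] [Normal K Fbar]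
  {E : WeierstrassCurve F} [E.IsElliptic] {l : ℕ} {Pb : BadPlacePredicates K}
  (D : InitialThetaData F K Fbar E l Pb)
  {Ω : Type w'} [Field Ω] [Algebra K Ω]
  (k : Type w') [Field k] [Algebra K k] [Algebra k Ω] [IsScalarTower K k Ω] (ι : Fbar →ₐ[K] Ω)

/-- **`Π_{(−)_v̲} ↠ Gal(Ω/k)` is SURJECTIVE for every `Π_{(−)} ⊇ Π_{X̲_K}`** (Def. 3.1 (e) "natural outer surjections onto
the decomposition group"; `k = K_v̲`, `ρ = localToGF F k ι` with image `G_v̲ ⊆ G_K`).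
[claim: Mochizuki2012, status: disputed] -/
theorem augLoc_localToGF_surjective_of_PiXund_le {H : Subgroup D.PiC} (hH : D.PiXund ≤ H) :
    Function.Surjective (D.augLoc H (localToGF F k ι)) :=
  D.augLoc_surjective H (localToGF F k ι)
    ((decompositionSubgroupGF_le F k ι).trans (D.galoisSubgroupOf_le_map_of_PiXund_le hH))

/-- **`Π_{X_v̲} ↠ Gal(Ω/k)` is open** (`Π_{X_v̲} := Π_{X_K} ×_{G_F} Gal(Ω/k)`), hypothesis-free.
[claim: Mochizuki2012, status: disputed] -/
theorem isOpenMap_augLoc_PiXK : IsOpenMap (D.augLoc D.PiXK (localToGF F k ι)) :=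
  D.isOpenMap_augLoc D.PiXK (localToGF F k ι) D.isOpen_PiXK (continuous_localToGF F k ι)

/-- **`Π_{C_v̲} ↠ Gal(Ω/k)` is open** (`Π_{C_v̲} := Π_{C_K} ×_{G_F} Gal(Ω/k)`), hypothesis-free.
[claim: Mochizuki2012, status: disputed] -/
theorem isOpenMap_augLoc_PiCK : IsOpenMap (D.augLoc D.PiCK (localToGF F k ι)) :=
  D.isOpenMap_augLoc D.PiCK (localToGF F k ι) D.isOpen_PiCK (continuous_localToGF F k ι)

/-- **`Π_{X̲_v̲} ↠ Gal(Ω/k)` is open** (`Π_{X̲_v̲} := Π_{X̲_K} ×_{G_F} Gal(Ω/k)`), hypothesis-free.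
[claim: Mochizuki2012, status: disputed] -/
theorem isOpenMap_augLoc_PiXund : IsOpenMap (D.augLoc D.PiXund (localToGF F k ι)) :=
  D.isOpenMap_augLoc D.PiXund (localToGF F k ι) D.isOpen_PiXund (continuous_localToGF F k ι)

/-- **`Π_{C̲_v̲} ↠ Gal(Ω/k)` is open** (`Π_{C̲_v̲} := Π_{C̲_K} ×_{G_F} Gal(Ω/k)`), hypothesis-free.
[claim: Mochizuki2012, status: disputed] -/
theorem isOpenMap_augLoc_PiCund : IsOpenMap (D.augLoc D.PiCund (localToGF F k ι)) :=
  D.isOpenMap_augLoc D.PiCund (localToGF F k ι) D.isOpen_PiCund (continuous_localToGF F k ι)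

end BaseChange

end InitialThetaData

end Literature.IUT.HodgeTheaters

end
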